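import Summits.BirchSwinnertonDyer.BirchSwinnertonDyer.Theorems.KimAtThreeFineKatoDefinedLambdaExpStarDefs
import Summits.BirchSwinnertonDyer.BirchSwinnertonDyer.Theorems.KimAtThreeFineKatoPrintClauses
import HarnessLib

/-!
# Kato's value datum DEFINED, III — the displayed clause (DEF₀) is a THEOREM about `katoLambda`; `ZetaBody`
# (C3a)/(C3b) for `katoLambda`; uniqueness of `Ψ` (crux `KatoKuriharaPortThreeShared`, stmt-BirchSwinnertonDyer-19560;
# cell `bsd-addord`, seat w2-acc5 gen 6; route W2 `KimAtThreeKolyvagin`; `--supports 19560`, helper)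

HONEST FRAMING.  TOOL theorems only (no definition, no named fact, no instance, no `sorry`); closes nothing;
nothing is booked; BSD is not proved by any of this.

WHAT.  `KimAtThreeFineKatoDefinedLambdaExpStarDefs` DEFINES Kato's dual-exponential value datum
`katoLambda … : H¹(U_{k,r}, T_pW) →ₗ[ℤ_p] ℚ_p ⊗ ℚ(ζ_m)` (single-completion semi-local `exp*`, §9.4).  The packages of
record for crux 19560 (`hKatoV2₀`, kim3 g15 `KimAtThreeFineKatoPerFactorPartsSingle`; `zetaBody_C3_of_level`,
`KimAtThreeFineKatoPrintClauses`) bind an abstract `Λ` and DISPLAY its definition on cocycles as the clause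
**(DEF₀)** «`[φ''] = g_w · y → (∀ σ, ψT σ = φ'' (t σ)) → Ψ (Λ y)_w = (g̃_w⁻¹)_* (exp*_{w₀} [ψT])`».  THIS FILE proves:

* `cocycleDef_katoLambda` — **(DEF₀) VERBATIM for `Λ := katoLambda …`** (every `p`, `k`, `r`): the displayed clause
  is a theorem about the defined object (`apply_katoLambda` ∘ `expStarTowerMap_apply` ∘ w2-acc5 g4
  `factorDef_of_H1toInt`);
* `algEquiv_apply_eq_of_tmul` — two `Ψ, Ψ' : ℚ_p ⊗ L ≃ ∏_w L_w` with the pure-tensor formula AGREE (so the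
  `∀ Ψ, hΨ → …` binders of the packages are about ONE map, and `katoLambda` built with any admissible `Ψ'` meets
  (DEF₀) stated with any admissible `Ψ`): `cocycleDef_katoLambda_of_tmul`;
* `zetaBody_C3_katoLambda` — at `p = 3`, **`ZetaBody` (C3a) ∧ (C3b) for `katoLambda`** from (RES₀) + `hdual` alone
  (kim3 g15 `zetaBody_C3_of_level` with its (DEF₀) hypothesis discharged by `cocycleDef_katoLambda`).

So a package displaying `∃ Λ, … (DEF₀) ∧ ZetaBody(Λ)` can be replaced by one NAMING `Λ := fun k r => katoLambda …`
with (DEF₀) dropped and (C3a)/(C3b) kernel (sequel `KimAtThreeFineKatoDefinedLambdaKatoV2`: `hKatoDef → hKatoV2₀`).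

References: K. Kato, Astérisque 295 (2004) §9.4, Thm. 9.7 [Kato2004Asterisque]; K. Kato, LNM 1553 (1993) II §1.2.4
[Kato1993LNM1553]; J. W. S. Cassels, A. Fröhlich (1967) Ch. II §10 (10.2), Ch. VII §1.1 [CasselsFrohlichANT1967];
J.-P. Serre, *Galois Cohomology* (1997) I §2.4 [SerreGaloisCohomology1997].
-/

noncomputable section

-- the cell's Theorems namespace `Summit.BirchSwinnertonDyer.BirchSwinnertonDyer.…` repeats the summit name by design (D-0017)
set_option linter.dupNamespace false

open scoped Classical NumberField ContRepresentation TensorProduct Pointwise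
open Field ValuativeRel NumberField IsDedekindDomain
open WeierstrassCurve Literature.NumberTheory.EllipticCurves Literature.NumberTheory.GaloisRepresentations
  Literature.NumberTheory.GaloisRepresentations.DiscreteGaloisModule
  Literature.NumberTheory.EllipticCurves.Kato2004.EulerSystemValues
open Literature.NumberTheory.GaloisRepresentations.PeriodRingData Literature.NumberTheory.PAdicHodge
open Literature.NumberTheory.EllipticCurves.Rank1Residual
open Literature.NumberTheory.AdelicBaseChange Literature.NumberTheory.Automorphic
open Summit.BirchSwinnertonDyer.Rank1Residual.GaloisImage
open Summit.BirchSwinnertonDyer.Rank1Residual.Additive.LocalLog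
open Summit.BirchSwinnertonDyer.BirchSwinnertonDyer.Theorems.KimAtThreeFineKatoLevelCompat
open Summit.BirchSwinnertonDyer.BirchSwinnertonDyer.Theorems.KimAtThreeFineKatoLevelCompatDef
open Summit.BirchSwinnertonDyer.BirchSwinnertonDyer.Theorems.KimAtThreeDeepLowerExpStarOmega
open Summit.BirchSwinnertonDyer.BirchSwinnertonDyer.Theorems.KimAtThreeDeepLowerExpStarOmegaPlace
open Summit.BirchSwinnertonDyer.BirchSwinnertonDyer.Theorems.KimAtThreeFineKatoPerFactorPlaces
open Summit.BirchSwinnertonDyer.BirchSwinnertonDyer.Theorems.KimAtThreeFineKatoPrintClauses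

namespace Summit.BirchSwinnertonDyer.BirchSwinnertonDyer.Theorems.KimAtThreeFineKatoDefinedLambda

/-! ### §1 (DEF₀) on cocycles, verbatim, for `katoLambda` (every `p`) -/

section CocycleDef

variable (W : WeierstrassCurve ℚ) [W.IsElliptic] (p : ℕ) [hp : Fact p.Prime]
  [ContinuousSMul ℤ_[p] (W.tateModule p)] (k : ℕ) (r : Finset (HeightOneSpectrum (𝓞 ℚ)))
  (w₀ : ((Rat.HeightOneSpectrum.primesEquiv (R := 𝓞 ℚ)).symm ⟨p, Fact.out⟩).Extension
    (𝓞 (CyclotomicField (cycLevel p k r) ℚ)))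
  (Ψ : ℚ_[p] ⊗[ℚ] CyclotomicField (cycLevel p k r) ℚ ≃ₐ[ℚ]
    (Π w : ((Rat.HeightOneSpectrum.primesEquiv (R := 𝓞 ℚ)).symm ⟨p, Fact.out⟩).Extension
      (𝓞 (CyclotomicField (cycLevel p k r) ℚ)), w.1.adicCompletion (CyclotomicField (cycLevel p k r) ℚ)))
  (hΨ : ∀ (s : ℚ_[p]) (x : CyclotomicField (cycLevel p k r) ℚ)
    (w : ((Rat.HeightOneSpectrum.primesEquiv (R := 𝓞 ℚ)).symm ⟨p, Fact.out⟩).Extension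
      (𝓞 (CyclotomicField (cycLevel p k r) ℚ))),
    Ψ (s ⊗ₜ[ℚ] x) w = algebraMap (CyclotomicField (cycLevel p k r) ℚ)
        (w.1.adicCompletion (CyclotomicField (cycLevel p k r) ℚ)) x *
      algebraMap (((Rat.HeightOneSpectrum.primesEquiv (R := 𝓞 ℚ)).symm ⟨p, Fact.out⟩).adicCompletion ℚ)
        (w.1.adicCompletion (CyclotomicField (cycLevel p k r) ℚ)) (Padic.adicCompletionEquiv (𝓞 ℚ) ⟨p, Fact.out⟩ s))
  (hw₀ : ((p : ℕ) : 𝓞 (CyclotomicField (cycLevel p k r) ℚ)) ∈ w₀.1.asIdeal)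
  (g : ((Rat.HeightOneSpectrum.primesEquiv (R := 𝓞 ℚ)).symm ⟨p, Fact.out⟩).Extension
    (𝓞 (CyclotomicField (cycLevel p k r) ℚ)) → absoluteGaloisGroup ℚ)
  (hg : ∀ w : ((Rat.HeightOneSpectrum.primesEquiv (R := 𝓞 ℚ)).symm ⟨p, Fact.out⟩).Extension
      (𝓞 (CyclotomicField (cycLevel p k r) ℚ)),
    sigma (cycLevel p k r) (modNCyclotomicCharacter ℚ (cycLevel p k r) (g w)) • w.1 = w₀.1)

set_option backward.isDefEq.respectTransparency false in
/-- **(DEF₀) VERBATIM for the defined `Λ := katoLambda …`** (every `p`, `k`, `r`): for every `w ∣ p`, every level class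
`y`, every cocycle `φ''` representing `g_w · y` and every tower cocycle `ψT` of `φ''` at `L_{w₀}`,
`Ψ (Λ y)_w = (g̃_w⁻¹)_* (exp*_{w₀} [ψT])` — the clause the packages of crux 19560 DISPLAY about an abstract `Λ`
(`hKatoV2₀` of `KimAtThreeFineKatoPerFactorPartsSingle`, `zetaBody_C3_of_level` of `KimAtThreeFineKatoPrintClauses`),
now a theorem (`apply_katoLambda`, `expStarTowerMap_apply`, w2-acc5 g4 `factorDef_of_H1toInt`).
[cite: Kato2004Asterisque, §9.4 (p. 188)] [cite: SerreGaloisCohomology1997, I §2.4] -/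
theorem cocycleDef_katoLambda :
    letI := LocalField.charZero_adicCompletion w₀.1
    letI := LocalField.adicCompletionPadicAlgebra w₀.1 p hw₀
    haveI : Fact (¬ IsUnit ((p : ℕ) : integerC (w₀.1.adicCompletion (CyclotomicField (cycLevel p k r) ℚ)))) :=
      ⟨not_isUnit_natCast_integerC (LocalField.valuation_adicCompletion_natCast_lt_one w₀.1 p hw₀)⟩
    haveI := isAdicComplete_integerC_natCast (LocalField.valuation_adicCompletion_natCast_lt_one w₀.1 p hw₀)
    ∀ (dw : LocalNeronLine W (LocalField.valuation_adicCompletion_natCast_lt_one w₀.1 p hw₀)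
        ((galRestrictPlace ((Rat.HeightOneSpectrum.primesEquiv (R := 𝓞 ℚ)).symm ⟨p, Fact.out⟩)).comp
          (absGaloisRestrict (((Rat.HeightOneSpectrum.primesEquiv (R := 𝓞 ℚ)).symm ⟨p, Fact.out⟩).adicCompletion ℚ)
            (w₀.1.adicCompletion (CyclotomicField (cycLevel p k r) ℚ)))))
      (hinjw : (bdRPeriodRingData (LocalField.valuation_adicCompletion_natCast_lt_one w₀.1 p hw₀)).CupLogInjective
        (logCyclotomic p) (localRationalTateRep W p ((galRestrictPlace ((Rat.HeightOneSpectrum.primesEquiv (R := 𝓞 ℚ)).symm ⟨p, Fact.out⟩)).comp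
          (absGaloisRestrict (((Rat.HeightOneSpectrum.primesEquiv (R := 𝓞 ℚ)).symm ⟨p, Fact.out⟩).adicCompletion ℚ)
            (w₀.1.adicCompletion (CyclotomicField (cycLevel p k r) ℚ))))))
      (hexw : ∀ z : contOneCocycles (localRationalTateRep W p ((galRestrictPlace ((Rat.HeightOneSpectrum.primesEquiv (R := 𝓞 ℚ)).symm ⟨p, Fact.out⟩)).comp
          (absGaloisRestrict (((Rat.HeightOneSpectrum.primesEquiv (R := 𝓞 ℚ)).symm ⟨p, Fact.out⟩).adicCompletion ℚ)
            (w₀.1.adicCompletion (CyclotomicField (cycLevel p k r) ℚ))))).toTopRep,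
        (bdRPeriodRingData (LocalField.valuation_adicCompletion_natCast_lt_one w₀.1 p hw₀)).HasDualExp
          (logCyclotomic p) (localRationalTateRep W p ((galRestrictPlace ((Rat.HeightOneSpectrum.primesEquiv (R := 𝓞 ℚ)).symm ⟨p, Fact.out⟩)).comp
          (absGaloisRestrict (((Rat.HeightOneSpectrum.primesEquiv (R := 𝓞 ℚ)).symm ⟨p, Fact.out⟩).adicCompletion ℚ)
            (w₀.1.adicCompletion (CyclotomicField (cycLevel p k r) ℚ))))) fun σ => z.1 σ)
      (w : ((Rat.HeightOneSpectrum.primesEquiv (R := 𝓞 ℚ)).symm ⟨p, Fact.out⟩).Extension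
        (𝓞 (CyclotomicField (cycLevel p k r) ℚ)))
      (y : H1 (tateRep W p) (cycSubgroup p k r))
      (φ'' : contOneCocycles (subgroupRep (tateRep W p).toTopRep (cycSubgroup p k r)))
      (ψT : contOneCocycles ((tateLocalRep W p (Sum.inr ((Rat.HeightOneSpectrum.primesEquiv (R := 𝓞 ℚ)).symm ⟨p, Fact.out⟩))).restrict
        (absGaloisRestrict (((Rat.HeightOneSpectrum.primesEquiv (R := 𝓞 ℚ)).symm ⟨p, Fact.out⟩).adicCompletion ℚ)
          (w₀.1.adicCompletion (CyclotomicField (cycLevel p k r) ℚ)))).toTopRep),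
      oneCocycleClass _ φ'' = conjMap (tateRep W p).toTopRep (cycSubgroup p k r) (g w) 1 y →
      (∀ σ, ψT.1 σ = φ''.1 ⟨absGaloisRestrictTower ℚ (((Rat.HeightOneSpectrum.primesEquiv (R := 𝓞 ℚ)).symm ⟨p, Fact.out⟩).adicCompletion ℚ)
        (w₀.1.adicCompletion (CyclotomicField (cycLevel p k r) ℚ)) σ,
        absGaloisRestrictTower_adicCompletion_mem_cycSubgroup_prime p k r w₀ σ⟩) →
      Ψ (katoLambda W p k r w₀ Ψ hΨ hw₀ g hg dw hinjw hexw y) w = galAdicCompletionMap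
        (sigma (cycLevel p k r) (modNCyclotomicCharacter ℚ (cycLevel p k r) (g w)))⁻¹
        (inv_smul_eq_of_smul_eq (hg w))
        (expStarOmegaHom (LocalField.valuation_adicCompletion_natCast_lt_one w₀.1 p hw₀)
          ((galRestrictPlace ((Rat.HeightOneSpectrum.primesEquiv (R := 𝓞 ℚ)).symm ⟨p, Fact.out⟩)).comp
            (absGaloisRestrict (((Rat.HeightOneSpectrum.primesEquiv (R := 𝓞 ℚ)).symm ⟨p, Fact.out⟩).adicCompletion ℚ)
              (w₀.1.adicCompletion (CyclotomicField (cycLevel p k r) ℚ)))) dw hinjw hexw (oneCocycleClass _ ψT)) := by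
  intro dw hinjw hexw w y φ'' ψT hφ'' hψT
  letI := LocalField.charZero_adicCompletion w₀.1
  letI := LocalField.adicCompletionPadicAlgebra w₀.1 p hw₀
  haveI : Fact (¬ IsUnit ((p : ℕ) : integerC (w₀.1.adicCompletion (CyclotomicField (cycLevel p k r) ℚ)))) :=
    ⟨not_isUnit_natCast_integerC (LocalField.valuation_adicCompletion_natCast_lt_one w₀.1 p hw₀)⟩
  haveI := isAdicComplete_integerC_natCast (LocalField.valuation_adicCompletion_natCast_lt_one w₀.1 p hw₀)
  letI : Algebra (Place.Completion (K := ℚ) (Sum.inr ((Rat.HeightOneSpectrum.primesEquiv (R := 𝓞 ℚ)).symm ⟨p, Fact.out⟩)))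
      (w₀.1.adicCompletion (CyclotomicField (cycLevel p k r) ℚ)) :=
    inferInstanceAs (Algebra (((Rat.HeightOneSpectrum.primesEquiv (R := 𝓞 ℚ)).symm ⟨p, Fact.out⟩).adicCompletion ℚ)
      (w₀.1.adicCompletion (CyclotomicField (cycLevel p k r) ℚ)))
  rw [apply_katoLambda, expStarTowerMap_apply]
  exact congrArg _ (factorDef_of_H1toInt W p k r ((Rat.HeightOneSpectrum.primesEquiv (R := 𝓞 ℚ)).symm ⟨p, Fact.out⟩)
    (w₀.1.adicCompletion (CyclotomicField (cycLevel p k r) ℚ))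
    (absGaloisRestrictTower_adicCompletion_mem_cycSubgroup_prime p k r w₀)
    (expStarOmegaHom (LocalField.valuation_adicCompletion_natCast_lt_one w₀.1 p hw₀)
      ((galRestrictPlace ((Rat.HeightOneSpectrum.primesEquiv (R := 𝓞 ℚ)).symm ⟨p, Fact.out⟩)).comp
        (absGaloisRestrict (((Rat.HeightOneSpectrum.primesEquiv (R := 𝓞 ℚ)).symm ⟨p, Fact.out⟩).adicCompletion ℚ)
          (w₀.1.adicCompletion (CyclotomicField (cycLevel p k r) ℚ)))) dw hinjw hexw) _ φ'' hφ'' ψT hψT)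

omit [W.IsElliptic] [ContinuousSMul ℤ_[p] (W.tateModule p)] in
include hΨ in
/-- **Uniqueness of `Ψ`**: two `ℚ`-algebra isomorphisms `ℚ_p ⊗ ℚ(ζ_m) ≃ ∏_{w ∣ p} L_w` with the pure-tensor formula
`Ψ(s ⊗ x)_w = x · e_p(s)` agree (pure tensors span; Cassels–Fröhlich II §10 (10.2) — the map is canonical).  So the
`∀ Ψ, hΨ → …` binders of the 19560 packages speak about ONE map.
[cite: CasselsFrohlichANT1967, Ch. II §10 Theorem (10.2)] -/
theorem algEquiv_apply_eq_of_tmul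
    (Ψ' : ℚ_[p] ⊗[ℚ] CyclotomicField (cycLevel p k r) ℚ ≃ₐ[ℚ]
      (Π w : ((Rat.HeightOneSpectrum.primesEquiv (R := 𝓞 ℚ)).symm ⟨p, Fact.out⟩).Extension
        (𝓞 (CyclotomicField (cycLevel p k r) ℚ)), w.1.adicCompletion (CyclotomicField (cycLevel p k r) ℚ)))
    (hΨ' : ∀ (s : ℚ_[p]) (x : CyclotomicField (cycLevel p k r) ℚ)
      (w : ((Rat.HeightOneSpectrum.primesEquiv (R := 𝓞 ℚ)).symm ⟨p, Fact.out⟩).Extension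
        (𝓞 (CyclotomicField (cycLevel p k r) ℚ))),
      Ψ' (s ⊗ₜ[ℚ] x) w = algebraMap (CyclotomicField (cycLevel p k r) ℚ)
          (w.1.adicCompletion (CyclotomicField (cycLevel p k r) ℚ)) x *
        algebraMap (((Rat.HeightOneSpectrum.primesEquiv (R := 𝓞 ℚ)).symm ⟨p, Fact.out⟩).adicCompletion ℚ)
          (w.1.adicCompletion (CyclotomicField (cycLevel p k r) ℚ)) (Padic.adicCompletionEquiv (𝓞 ℚ) ⟨p, Fact.out⟩ s))
    (t : ℚ_[p] ⊗[ℚ] CyclotomicField (cycLevel p k r) ℚ) : Ψ t = Ψ' t := by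
  induction t using TensorProduct.induction_on with
  | zero => simp
  | tmul s x => funext w; rw [hΨ, hΨ']
  | add t₁ t₂ h₁ h₂ => rw [map_add, map_add, h₁, h₂]

include hΨ in
set_option backward.isDefEq.respectTransparency false in
/-- **(DEF₀) for `katoLambda` built with `Ψ'`, stated with ANY admissible `Ψ`** (the form the `∀ Ψ, hΨ → ∃ …, (DEF₀)`
binder of `hKatoV2₀` asks for): `cocycleDef_katoLambda` ∘ `algEquiv_apply_eq_of_tmul`.
[cite: Kato2004Asterisque, §9.4 (p. 188)] [cite: CasselsFrohlichANT1967, Ch. II §10 Theorem (10.2)] -/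
theorem cocycleDef_katoLambda_of_tmul
    (Ψ' : ℚ_[p] ⊗[ℚ] CyclotomicField (cycLevel p k r) ℚ ≃ₐ[ℚ]
      (Π w : ((Rat.HeightOneSpectrum.primesEquiv (R := 𝓞 ℚ)).symm ⟨p, Fact.out⟩).Extension
        (𝓞 (CyclotomicField (cycLevel p k r) ℚ)), w.1.adicCompletion (CyclotomicField (cycLevel p k r) ℚ)))
    (hΨ' : ∀ (s : ℚ_[p]) (x : CyclotomicField (cycLevel p k r) ℚ)
      (w : ((Rat.HeightOneSpectrum.primesEquiv (R := 𝓞 ℚ)).symm ⟨p, Fact.out⟩).Extension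
        (𝓞 (CyclotomicField (cycLevel p k r) ℚ))),
      Ψ' (s ⊗ₜ[ℚ] x) w = algebraMap (CyclotomicField (cycLevel p k r) ℚ)
          (w.1.adicCompletion (CyclotomicField (cycLevel p k r) ℚ)) x *
        algebraMap (((Rat.HeightOneSpectrum.primesEquiv (R := 𝓞 ℚ)).symm ⟨p, Fact.out⟩).adicCompletion ℚ)
          (w.1.adicCompletion (CyclotomicField (cycLevel p k r) ℚ)) (Padic.adicCompletionEquiv (𝓞 ℚ) ⟨p, Fact.out⟩ s)) :
    letI := LocalField.charZero_adicCompletion w₀.1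
    letI := LocalField.adicCompletionPadicAlgebra w₀.1 p hw₀
    haveI : Fact (¬ IsUnit ((p : ℕ) : integerC (w₀.1.adicCompletion (CyclotomicField (cycLevel p k r) ℚ)))) :=
      ⟨not_isUnit_natCast_integerC (LocalField.valuation_adicCompletion_natCast_lt_one w₀.1 p hw₀)⟩
    haveI := isAdicComplete_integerC_natCast (LocalField.valuation_adicCompletion_natCast_lt_one w₀.1 p hw₀)
    ∀ (dw : LocalNeronLine W (LocalField.valuation_adicCompletion_natCast_lt_one w₀.1 p hw₀)
        ((galRestrictPlace ((Rat.HeightOneSpectrum.primesEquiv (R := 𝓞 ℚ)).symm ⟨p, Fact.out⟩)).comp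
          (absGaloisRestrict (((Rat.HeightOneSpectrum.primesEquiv (R := 𝓞 ℚ)).symm ⟨p, Fact.out⟩).adicCompletion ℚ)
            (w₀.1.adicCompletion (CyclotomicField (cycLevel p k r) ℚ)))))
      (hinjw : (bdRPeriodRingData (LocalField.valuation_adicCompletion_natCast_lt_one w₀.1 p hw₀)).CupLogInjective
        (logCyclotomic p) (localRationalTateRep W p ((galRestrictPlace ((Rat.HeightOneSpectrum.primesEquiv (R := 𝓞 ℚ)).symm ⟨p, Fact.out⟩)).comp
          (absGaloisRestrict (((Rat.HeightOneSpectrum.primesEquiv (R := 𝓞 ℚ)).symm ⟨p, Fact.out⟩).adicCompletion ℚ)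
            (w₀.1.adicCompletion (CyclotomicField (cycLevel p k r) ℚ))))))
      (hexw : ∀ z : contOneCocycles (localRationalTateRep W p ((galRestrictPlace ((Rat.HeightOneSpectrum.primesEquiv (R := 𝓞 ℚ)).symm ⟨p, Fact.out⟩)).comp
          (absGaloisRestrict (((Rat.HeightOneSpectrum.primesEquiv (R := 𝓞 ℚ)).symm ⟨p, Fact.out⟩).adicCompletion ℚ)
            (w₀.1.adicCompletion (CyclotomicField (cycLevel p k r) ℚ))))).toTopRep,
        (bdRPeriodRingData (LocalField.valuation_adicCompletion_natCast_lt_one w₀.1 p hw₀)).HasDualExp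
          (logCyclotomic p) (localRationalTateRep W p ((galRestrictPlace ((Rat.HeightOneSpectrum.primesEquiv (R := 𝓞 ℚ)).symm ⟨p, Fact.out⟩)).comp
          (absGaloisRestrict (((Rat.HeightOneSpectrum.primesEquiv (R := 𝓞 ℚ)).symm ⟨p, Fact.out⟩).adicCompletion ℚ)
            (w₀.1.adicCompletion (CyclotomicField (cycLevel p k r) ℚ))))) fun σ => z.1 σ)
      (w : ((Rat.HeightOneSpectrum.primesEquiv (R := 𝓞 ℚ)).symm ⟨p, Fact.out⟩).Extension
        (𝓞 (CyclotomicField (cycLevel p k r) ℚ)))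
      (y : H1 (tateRep W p) (cycSubgroup p k r))
      (φ'' : contOneCocycles (subgroupRep (tateRep W p).toTopRep (cycSubgroup p k r)))
      (ψT : contOneCocycles ((tateLocalRep W p (Sum.inr ((Rat.HeightOneSpectrum.primesEquiv (R := 𝓞 ℚ)).symm ⟨p, Fact.out⟩))).restrict
        (absGaloisRestrict (((Rat.HeightOneSpectrum.primesEquiv (R := 𝓞 ℚ)).symm ⟨p, Fact.out⟩).adicCompletion ℚ)
          (w₀.1.adicCompletion (CyclotomicField (cycLevel p k r) ℚ)))).toTopRep),
      oneCocycleClass _ φ'' = conjMap (tateRep W p).toTopRep (cycSubgroup p k r) (g w) 1 y →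
      (∀ σ, ψT.1 σ = φ''.1 ⟨absGaloisRestrictTower ℚ (((Rat.HeightOneSpectrum.primesEquiv (R := 𝓞 ℚ)).symm ⟨p, Fact.out⟩).adicCompletion ℚ)
        (w₀.1.adicCompletion (CyclotomicField (cycLevel p k r) ℚ)) σ,
        absGaloisRestrictTower_adicCompletion_mem_cycSubgroup_prime p k r w₀ σ⟩) →
      Ψ (katoLambda W p k r w₀ Ψ' hΨ' hw₀ g hg dw hinjw hexw y) w = galAdicCompletionMap
        (sigma (cycLevel p k r) (modNCyclotomicCharacter ℚ (cycLevel p k r) (g w)))⁻¹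
        (inv_smul_eq_of_smul_eq (hg w))
        (expStarOmegaHom (LocalField.valuation_adicCompletion_natCast_lt_one w₀.1 p hw₀)
          ((galRestrictPlace ((Rat.HeightOneSpectrum.primesEquiv (R := 𝓞 ℚ)).symm ⟨p, Fact.out⟩)).comp
            (absGaloisRestrict (((Rat.HeightOneSpectrum.primesEquiv (R := 𝓞 ℚ)).symm ⟨p, Fact.out⟩).adicCompletion ℚ)
              (w₀.1.adicCompletion (CyclotomicField (cycLevel p k r) ℚ)))) dw hinjw hexw (oneCocycleClass _ ψT)) := by
  intro dw hinjw hexw w y φ'' ψT hφ'' hψT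
  rw [algEquiv_apply_eq_of_tmul p k r Ψ hΨ Ψ' hΨ']
  exact cocycleDef_katoLambda W p k r w₀ Ψ' hΨ' hw₀ g hg dw hinjw hexw w y φ'' ψT hφ'' hψT

end CocycleDef

/-! ### §2 `ZetaBody` (C3a)/(C3b) for `katoLambda` at `p = 3`, from (RES₀) + `hdual` alone -/

section ZetaBodyC3

set_option backward.isDefEq.respectTransparency false in
set_option maxHeartbeats 400000 in
/-- **`ZetaBody` (C3a) and (C3b) for the DEFINED value datum `Λ_{k,r} := katoLambda …` at `p = 3`**, from the
`hdual`-normalised line datum `d` at `ℚ_{v₃}`, the chart `(Ψ, w₀, g)` and a line datum `dw` at `L_{w₀}` with (RES₀) —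
kim3 g15's `zetaBody_C3_of_level` (which displays (DEF₀) for an abstract `Λ_{k,r}`) with its (DEF₀) hypothesis
DISCHARGED by `cocycleDef_katoLambda`: for the defined `Λ` the two own-attribution clauses of `Kato2004.ZetaBody` cost
(RES₀) and `hdual` only (`maxHeartbeats 400000` as in the lemma it instantiates: four displayed packages in one
signature). [cite: Kato2004Asterisque, §9.4 (p. 188)] [cite: Kato1993LNM1553, Ch. II §1.2.4 and Prop. 1.2.3]
[cite: NeukirchANT1999, Ch. II §9 Prop. (9.6)] [cite: SerreLocalFields1979, VII §5 Prop. 3] -/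
theorem zetaBody_C3_katoLambda (W : WeierstrassCurve ℚ) [W.IsElliptic] [W.IsGloballyMinimal]
    [ContinuousSMul ℤ_[3] (W.tateModule 3)] [Module.Free ℤ_[3] (W.tateModule 3)]
    [Module.Finite ℤ_[3] (W.tateModule 3)]
    (hadd : haveI : Fact (Nat.Prime 3) := ⟨Nat.prime_three⟩; Addv W 3)
    (hc : ¬ 3 ∣ (W.baseChange ℚ_[3]).localTamagawaNumber ℤ_[3])
    (ht : Nat.card {Q : (W.baseChange ℚ_[3]).toAffine.Point // (3 : ℕ) • Q = 0} = 1)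
    (k : ℕ) (r : Finset (HeightOneSpectrum (𝓞 ℚ))) :
    haveI : Fact (((3 : ℕ) : 𝓞 ℚ) ∈ ((Rat.HeightOneSpectrum.primesEquiv (R := 𝓞 ℚ)).symm ⟨3, Fact.out⟩).asIdeal) :=
      ⟨(natCast_mem_asIdeal_iff_eq_primesEquiv_symm _ Nat.prime_three).mpr rfl⟩
    letI := valuativeRelPlace ((Rat.HeightOneSpectrum.primesEquiv (R := 𝓞 ℚ)).symm ⟨3, Fact.out⟩)
    letI := topologicalSpacePlace ((Rat.HeightOneSpectrum.primesEquiv (R := 𝓞 ℚ)).symm ⟨3, Fact.out⟩)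
    haveI := isNonarchimedeanLocalField_place ((Rat.HeightOneSpectrum.primesEquiv (R := 𝓞 ℚ)).symm ⟨3, Fact.out⟩)
    haveI := charZero_place ((Rat.HeightOneSpectrum.primesEquiv (R := 𝓞 ℚ)).symm ⟨3, Fact.out⟩)
    letI := padicAlgebraPlace 3 ((Rat.HeightOneSpectrum.primesEquiv (R := 𝓞 ℚ)).symm ⟨3, Fact.out⟩)
    haveI := fact_not_isUnit_place 3 ((Rat.HeightOneSpectrum.primesEquiv (R := 𝓞 ℚ)).symm ⟨3, Fact.out⟩)
    haveI := isAdicComplete_place 3 ((Rat.HeightOneSpectrum.primesEquiv (R := 𝓞 ℚ)).symm ⟨3, Fact.out⟩)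
    ∀ (d : LocalNeronLineAt W 3 ((Rat.HeightOneSpectrum.primesEquiv (R := 𝓞 ℚ)).symm ⟨3, Fact.out⟩))
      (hinj : (bdRPeriodRingData (valuation_place_lt_one 3 ((Rat.HeightOneSpectrum.primesEquiv (R := 𝓞 ℚ)).symm ⟨3, Fact.out⟩))).CupLogInjective (logCyclotomic 3)
        (localRationalTateRep W 3 (galRestrictPlace ((Rat.HeightOneSpectrum.primesEquiv (R := 𝓞 ℚ)).symm ⟨3, Fact.out⟩))))
      (hex : ∀ z : contOneCocycles (localRationalTateRep W 3 (galRestrictPlace ((Rat.HeightOneSpectrum.primesEquiv (R := 𝓞 ℚ)).symm ⟨3, Fact.out⟩))).toTopRep,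
        (bdRPeriodRingData (valuation_place_lt_one 3 ((Rat.HeightOneSpectrum.primesEquiv (R := 𝓞 ℚ)).symm ⟨3, Fact.out⟩))).HasDualExp (logCyclotomic 3)
          (localRationalTateRep W 3 (galRestrictPlace ((Rat.HeightOneSpectrum.primesEquiv (R := 𝓞 ℚ)).symm ⟨3, Fact.out⟩))) fun σ => z.1 σ),
    (∀ a : ℚ_[3], (∃ y, (expStarOmegaPadicAt d hinj hex (((Padic.adicCompletionEquiv (𝓞 ℚ) ⟨3, Fact.out⟩).symm : (((Rat.HeightOneSpectrum.primesEquiv (R := 𝓞 ℚ)).symm ⟨3, Fact.out⟩).adicCompletion ℚ) →+* ℚ_[3]))) y = a) ↔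
        ∀ Q : (W.baseChange ℚ_[3]).toAffine.Point, ‖a * padicLog (W.baseChange ℚ_[3]) Q‖ ≤ 1) →
    ∀ (Ψ : ℚ_[3] ⊗[ℚ] CyclotomicField (cycLevel 3 k r) ℚ ≃ₐ[ℚ]
      (Π w : ((Rat.HeightOneSpectrum.primesEquiv (R := 𝓞 ℚ)).symm ⟨3, Fact.out⟩).Extension
        (𝓞 (CyclotomicField (cycLevel 3 k r) ℚ)), w.1.adicCompletion (CyclotomicField (cycLevel 3 k r) ℚ)))
    (hΨ : ∀ (s : ℚ_[3]) (x : CyclotomicField (cycLevel 3 k r) ℚ)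
      (w : ((Rat.HeightOneSpectrum.primesEquiv (R := 𝓞 ℚ)).symm ⟨3, Fact.out⟩).Extension
        (𝓞 (CyclotomicField (cycLevel 3 k r) ℚ))),
      Ψ (s ⊗ₜ[ℚ] x) w =
        algebraMap (CyclotomicField (cycLevel 3 k r) ℚ) (w.1.adicCompletion (CyclotomicField (cycLevel 3 k r) ℚ)) x *
        algebraMap (((Rat.HeightOneSpectrum.primesEquiv (R := 𝓞 ℚ)).symm ⟨3, Fact.out⟩).adicCompletion ℚ)
          (w.1.adicCompletion (CyclotomicField (cycLevel 3 k r) ℚ)) ((Padic.adicCompletionEquiv (𝓞 ℚ) ⟨3, Fact.out⟩) s))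
    (w₀ : ((Rat.HeightOneSpectrum.primesEquiv (R := 𝓞 ℚ)).symm ⟨3, Fact.out⟩).Extension
        (𝓞 (CyclotomicField (cycLevel 3 k r) ℚ)))
      (g : ((Rat.HeightOneSpectrum.primesEquiv (R := 𝓞 ℚ)).symm ⟨3, Fact.out⟩).Extension
        (𝓞 (CyclotomicField (cycLevel 3 k r) ℚ)) → absoluteGaloisGroup ℚ)
      (hg : ∀ w : ((Rat.HeightOneSpectrum.primesEquiv (R := 𝓞 ℚ)).symm ⟨3, Fact.out⟩).Extension
        (𝓞 (CyclotomicField (cycLevel 3 k r) ℚ)),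
        sigma (cycLevel 3 k r) (modNCyclotomicCharacter ℚ (cycLevel 3 k r) (g w)) • w.1 = w₀.1),
    letI := LocalField.charZero_adicCompletion w₀.1
    letI := LocalField.adicCompletionPadicAlgebra w₀.1 3 (three_mem_asIdeal_extension _ w₀)
    haveI : Fact (¬ IsUnit ((3 : ℕ) : integerC (w₀.1.adicCompletion (CyclotomicField (cycLevel 3 k r) ℚ)))) :=
      ⟨not_isUnit_natCast_integerC (LocalField.valuation_adicCompletion_natCast_lt_one w₀.1 3 (three_mem_asIdeal_extension _ w₀))⟩
    haveI := isAdicComplete_integerC_natCast (LocalField.valuation_adicCompletion_natCast_lt_one w₀.1 3 (three_mem_asIdeal_extension _ w₀))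
    ∀ (dw : LocalNeronLine W (LocalField.valuation_adicCompletion_natCast_lt_one w₀.1 3 (three_mem_asIdeal_extension _ w₀))
      ((galRestrictPlace ((Rat.HeightOneSpectrum.primesEquiv (R := 𝓞 ℚ)).symm ⟨3, Fact.out⟩)).comp
        (absGaloisRestrict (((Rat.HeightOneSpectrum.primesEquiv (R := 𝓞 ℚ)).symm ⟨3, Fact.out⟩).adicCompletion ℚ) (w₀.1.adicCompletion (CyclotomicField (cycLevel 3 k r) ℚ)))))
      (hinjw : (bdRPeriodRingData (LocalField.valuation_adicCompletion_natCast_lt_one w₀.1 3 (three_mem_asIdeal_extension _ w₀))).CupLogInjective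
      (logCyclotomic 3) (localRationalTateRep W 3 ((galRestrictPlace ((Rat.HeightOneSpectrum.primesEquiv (R := 𝓞 ℚ)).symm ⟨3, Fact.out⟩)).comp
        (absGaloisRestrict (((Rat.HeightOneSpectrum.primesEquiv (R := 𝓞 ℚ)).symm ⟨3, Fact.out⟩).adicCompletion ℚ) (w₀.1.adicCompletion (CyclotomicField (cycLevel 3 k r) ℚ))))))
      (hexw : ∀ z : contOneCocycles (localRationalTateRep W 3 ((galRestrictPlace ((Rat.HeightOneSpectrum.primesEquiv (R := 𝓞 ℚ)).symm ⟨3, Fact.out⟩)).comp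
        (absGaloisRestrict (((Rat.HeightOneSpectrum.primesEquiv (R := 𝓞 ℚ)).symm ⟨3, Fact.out⟩).adicCompletion ℚ) (w₀.1.adicCompletion (CyclotomicField (cycLevel 3 k r) ℚ))))).toTopRep,
      (bdRPeriodRingData (LocalField.valuation_adicCompletion_natCast_lt_one w₀.1 3 (three_mem_asIdeal_extension _ w₀))).HasDualExp
        (logCyclotomic 3) (localRationalTateRep W 3 ((galRestrictPlace ((Rat.HeightOneSpectrum.primesEquiv (R := 𝓞 ℚ)).symm ⟨3, Fact.out⟩)).comp
        (absGaloisRestrict (((Rat.HeightOneSpectrum.primesEquiv (R := 𝓞 ℚ)).symm ⟨3, Fact.out⟩).adicCompletion ℚ) (w₀.1.adicCompletion (CyclotomicField (cycLevel 3 k r) ℚ))))) fun σ => z.1 σ),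
    (∀ (h : (tateLocalRep W 3 (Sum.inr ((Rat.HeightOneSpectrum.primesEquiv (R := 𝓞 ℚ)).symm ⟨3, Fact.out⟩))).cohomology 1),
      (expStarOmegaHom (LocalField.valuation_adicCompletion_natCast_lt_one w₀.1 3 (three_mem_asIdeal_extension _ w₀))
        ((galRestrictPlace ((Rat.HeightOneSpectrum.primesEquiv (R := 𝓞 ℚ)).symm ⟨3, Fact.out⟩)).comp
        (absGaloisRestrict (((Rat.HeightOneSpectrum.primesEquiv (R := 𝓞 ℚ)).symm ⟨3, Fact.out⟩).adicCompletion ℚ) (w₀.1.adicCompletion (CyclotomicField (cycLevel 3 k r) ℚ)))) dw hinjw hexw)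
        (ContinuousRep.cohomologyRes (tateLocalRep W 3 (Sum.inr ((Rat.HeightOneSpectrum.primesEquiv (R := 𝓞 ℚ)).symm ⟨3, Fact.out⟩)))
          (absGaloisRestrict (((Rat.HeightOneSpectrum.primesEquiv (R := 𝓞 ℚ)).symm ⟨3, Fact.out⟩).adicCompletion ℚ) (w₀.1.adicCompletion (CyclotomicField (cycLevel 3 k r) ℚ))) 1 h) =
      algebraMap (((Rat.HeightOneSpectrum.primesEquiv (R := 𝓞 ℚ)).symm ⟨3, Fact.out⟩).adicCompletion ℚ) (w₀.1.adicCompletion (CyclotomicField (cycLevel 3 k r) ℚ)) (expStarOmegaAt d h)) →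
    (∀ (σ : absoluteGaloisGroup ℚ) (y : H1 (tateRep W 3) (cycSubgroup 3 k r)),
      (katoLambda W 3 k r w₀ Ψ hΨ (three_mem_asIdeal_extension _ w₀) g hg dw hinjw hexw) (conjMap (tateRep W 3).toTopRep (cycSubgroup 3 k r) σ 1 y) =
        Algebra.TensorProduct.map (AlgHom.id ℚ ℚ_[3])
          (sigma (cycLevel 3 k r) (modNCyclotomicCharacter ℚ (cycLevel 3 k r) σ) :
            CyclotomicField (cycLevel 3 k r) ℚ →ₐ[ℚ] CyclotomicField (cycLevel 3 k r) ℚ) ((katoLambda W 3 k r w₀ Ψ hΨ (three_mem_asIdeal_extension _ w₀) g hg dw hinjw hexw) y)) ∧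
    (∀ (y : H1 (tateRep W 3) (cycSubgroup 3 k r)),
      (∀ v : HeightOneSpectrum (𝓞 ℚ), ((Rat.HeightOneSpectrum.primesEquiv v : Nat.Primes) : ℕ) = 3 →
        ∀ 𝔓 ∈ v.primesAbove, resLe (tateRep W 3).toTopRep
          (inf_le_left : cycSubgroup 3 k r ⊓ MulAction.stabilizer (absoluteGaloisGroup ℚ) 𝔓 ≤ cycSubgroup 3 k r) 1 y = 0) →
      (katoLambda W 3 k r w₀ Ψ hΨ (three_mem_asIdeal_extension _ w₀) g hg dw hinjw hexw) y = 0) := by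

  haveI : Fact (((3 : ℕ) : 𝓞 ℚ) ∈ ((Rat.HeightOneSpectrum.primesEquiv (R := 𝓞 ℚ)).symm ⟨3, Fact.out⟩).asIdeal) :=
    ⟨(natCast_mem_asIdeal_iff_eq_primesEquiv_symm _ Nat.prime_three).mpr rfl⟩
  letI := valuativeRelPlace ((Rat.HeightOneSpectrum.primesEquiv (R := 𝓞 ℚ)).symm ⟨3, Fact.out⟩)
  letI := topologicalSpacePlace ((Rat.HeightOneSpectrum.primesEquiv (R := 𝓞 ℚ)).symm ⟨3, Fact.out⟩)
  haveI := isNonarchimedeanLocalField_place ((Rat.HeightOneSpectrum.primesEquiv (R := 𝓞 ℚ)).symm ⟨3, Fact.out⟩)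
  haveI := charZero_place ((Rat.HeightOneSpectrum.primesEquiv (R := 𝓞 ℚ)).symm ⟨3, Fact.out⟩)
  letI := padicAlgebraPlace 3 ((Rat.HeightOneSpectrum.primesEquiv (R := 𝓞 ℚ)).symm ⟨3, Fact.out⟩)
  haveI := fact_not_isUnit_place 3 ((Rat.HeightOneSpectrum.primesEquiv (R := 𝓞 ℚ)).symm ⟨3, Fact.out⟩)
  haveI := isAdicComplete_place 3 ((Rat.HeightOneSpectrum.primesEquiv (R := 𝓞 ℚ)).symm ⟨3, Fact.out⟩)
  intro d hinj hex hdual Ψ hΨ w₀ g hg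
  letI := LocalField.charZero_adicCompletion w₀.1
  letI := LocalField.adicCompletionPadicAlgebra w₀.1 3 (three_mem_asIdeal_extension _ w₀)
  haveI : Fact (¬ IsUnit ((3 : ℕ) : integerC (w₀.1.adicCompletion (CyclotomicField (cycLevel 3 k r) ℚ)))) :=
    ⟨not_isUnit_natCast_integerC (LocalField.valuation_adicCompletion_natCast_lt_one w₀.1 3 (three_mem_asIdeal_extension _ w₀))⟩
  haveI := isAdicComplete_integerC_natCast (LocalField.valuation_adicCompletion_natCast_lt_one w₀.1 3 (three_mem_asIdeal_extension _ w₀))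
  intro dw hinjw hexw hresw
  exact zetaBody_C3_of_level W hadd hc ht k r
    (katoLambda W 3 k r w₀ Ψ hΨ (three_mem_asIdeal_extension _ w₀) g hg dw hinjw hexw)
    d hinj hex hdual Ψ hΨ w₀ g hg dw hinjw hexw hresw
    (fun w y φ'' ψT hφ'' hψT =>
      cocycleDef_katoLambda W 3 k r w₀ Ψ hΨ (three_mem_asIdeal_extension _ w₀) g hg dw hinjw hexw w y φ'' ψT hφ'' hψT)

end ZetaBodyC3

end Summit.BirchSwinnertonDyer.BirchSwinnertonDyer.Theorems.KimAtThreeFineKatoDefinedLambda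

end
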